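import Mathlib.GroupTheory.OrderOfElement
import Mathlib.GroupTheory.Coset.Card
import Mathlib.Data.ZMod.QuotientGroup
import HarnessLib

/-!
# Crux `PrintCf2.SplitBadTwoRankOneOfFacts` (stmt-BirchSwinnertonDyer-20368), road α v10.3, S3c factor (F3), GLOBAL half:
# THE LEVEL DROP — a `p`-group of order `≤ p^M · B` containing a cyclic group of order `p^M` is pushed into it by `p^e ≥ B` (pure algebra)

Cell `bsd-print-cf2`, width seat `bsd-line-cf2-p1-w2` g11; `--supports stmt-BirchSwinnertonDyer-20368` (helper, Theses-free).
HONEST FRAMING: nothing here closes a crux or a stub; BSD is not proved by any of this; no summit statement is proved by this seat.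
No definition, no named fact, no `sorry`, no kit. beyond-print theorem: no (bookkeeping).

WHY (memo `Cruxes/SplitBadTwoRankOneOfFacts/F3-GLOBAL-w2g11.md` §4, infinite-level form). At infinite level the dual-side group of (F3) is
`Z_M := ι′_{M,*}(G′_M) ≤ H¹(Γ_K, W*′)[2^M]`; it contains the Kummer point `g′_M = e′_* res_⊤ κ_M(P)` of order `2^M` (-w6 g3's tower, conjugate
root) and has `#Z_M ≤ 2^M · B` UNIFORMLY in `M` (`…RestrictedSelmerUniformBound`, hfinB′). THIS FILE is the algebra that turns these two facts into
the level drop **`2^e · Z_M ⊆ ℤ · (2^e g′_M) = ℤ · g′_{M−e}`** for `2^e ≥ B`: the torsion classes `δ(W*′(K))`, which obstruct the drop at finite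
level, are invisible here because they die under `ι′_*`.
* `nsmul_mem_of_card_le` — `C ≤ Z`, `Z` killed by `p^M`, `#Z ≤ #C · B`, `B ≤ p^e` `⟹ p^e · Z ⊆ C`;
* **`pow_nsmul_mem_zmultiples_pow_nsmul`** — with `C = ℤ·g`, `addOrderOf g = p^M`, `e ≤ M`: `p^e · z ∈ ℤ · (p^e · g)` for every `z ∈ Z`;
* `comap_zmultiples_map_eq` — `f⁻¹(ℤ · f κ) = ℤ · κ + ker f` (reading a class on the Kummer line back at finite level).

References: A. Agboola, Compositio 143 (2007) §6 [Agboola2007]; R. Greenberg, LNM 1716 (1999) §5 proof of Prop. 5.8 [GreenbergLNM1716];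
D. Jetchev, C. Skinner, X. Wan, Camb. J. Math. 5 (2017) Prop. 3.3.2 [JetchevSkinnerWan2017].
-/

set_option autoImplicit false
set_option linter.dupNamespace false -- `Summit.BirchSwinnertonDyer.BirchSwinnertonDyer` (summit = problem) is the tree's layout

namespace Summit.BirchSwinnertonDyer.BirchSwinnertonDyer.Theorems.PrintCf2.LocalLineCount

variable {A : Type*} [AddCommGroup A] {p : ℕ} [hp : Fact p.Prime]

/-- **Bounded index pushes into the subgroup.** Let `Z ≤ A` be finite, killed by `p^M`, `C ≤ Z` with `#Z ≤ #C · B` and `B ≤ p^e`. Then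
`p^e · z ∈ C` for every `z ∈ Z` (every element of the `p`-group `Z/C`, of order `≤ B ≤ p^e`, has order a power of `p` at most `p^e`).
[folklore] -/
theorem nsmul_mem_of_card_le (Z C : AddSubgroup A) [Finite Z] (hCZ : C ≤ Z) {M e B : ℕ}
    (hZ : ∀ z ∈ Z, p ^ M • z = 0) (hcard : Nat.card Z ≤ Nat.card C * B) (hB : B ≤ p ^ e)
    {z : A} (hz : z ∈ Z) : p ^ e • z ∈ C := by
  classical
  -- the quotient `Q = Z / C`
  set C' : AddSubgroup Z := C.addSubgroupOf Z with hC'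
  have hC'card : Nat.card C' = Nat.card C := by
    rw [hC']; exact Nat.card_congr (AddSubgroup.addSubgroupOfEquivOfLe hCZ).toEquiv
  have hCpos : 0 < Nat.card C := by
    haveI : Finite C := Finite.of_injective (fun c : C ↦ (⟨c.1, hCZ c.2⟩ : Z))
      (fun a b h ↦ Subtype.ext (congrArg (fun q : ↥Z ↦ (q : A)) h))
    exact Nat.card_pos
  have hQcard : Nat.card (Z ⧸ C') ≤ B := by
    have h := C'.card_eq_card_quotient_mul_card_addSubgroup
    rw [hC'card] at h
    have h2 : Nat.card (↥Z ⧸ C') * Nat.card C ≤ B * Nat.card C := by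
      rw [← h, mul_comm B]; exact hcard
    exact Nat.le_of_mul_le_mul_right h2 hCpos
  -- the class of `z` has order `p^i ≤ B ≤ p^e`
  set q : ↥Z ⧸ C' := QuotientAddGroup.mk ⟨z, hz⟩ with hq
  have hqM : p ^ M • q = 0 := by
    rw [hq, ← QuotientAddGroup.mk_nsmul]
    have : (p ^ M • (⟨z, hz⟩ : Z)) = 0 := Subtype.ext (hZ z hz)
    rw [this, QuotientAddGroup.mk_zero]
  have hdvdM : addOrderOf q ∣ p ^ M := addOrderOf_dvd_of_nsmul_eq_zero hqM
  obtain ⟨i, hiM, hi⟩ := (Nat.dvd_prime_pow hp.out).mp hdvdM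
  have hile : p ^ i ≤ p ^ e := by
    calc p ^ i = addOrderOf q := hi.symm
      _ ≤ Nat.card (↥Z ⧸ C') := Nat.le_of_dvd Nat.card_pos (addOrderOf_dvd_natCard q)
      _ ≤ B := hQcard
      _ ≤ p ^ e := hB
  have hie : i ≤ e := (Nat.pow_le_pow_iff_right hp.out.one_lt).mp hile
  have hqe : p ^ e • q = 0 := by
    obtain ⟨k, hk⟩ := Nat.exists_eq_add_of_le hie
    rw [hk, pow_add, mul_comm, mul_nsmul', ← hi, addOrderOf_nsmul_eq_zero, smul_zero]
  -- read back in `A`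
  have hmem : (p ^ e • (⟨z, hz⟩ : Z)) ∈ C' := by
    rw [← QuotientAddGroup.eq_zero_iff, QuotientAddGroup.mk_nsmul, ← hq]; exact hqe
  rw [hC', AddSubgroup.mem_addSubgroupOf] at hmem
  simpa using hmem

/-- **THE LEVEL DROP.** Let `Z ≤ A` be finite, killed by `p^M`, containing `g` of order `p^M`, with `#Z ≤ p^M · B`, and let `B ≤ p^e`, `e ≤ M`.
Then for every `z ∈ Z`: **`p^e · z ∈ ℤ · (p^e · g)`** (the cyclic group of order `p^{M−e}`). In (F3): `Z = ι′_{M,*}(G′_M)`, `g = g′_M`,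
`p^e g′_M = g′_{M−e}` — every dual-side class, multiplied by `2^e`, lands on the Kummer line of level `M − e`. [folklore] -/
theorem pow_nsmul_mem_zmultiples_pow_nsmul (Z : AddSubgroup A) [Finite Z] {M e B : ℕ}
    (hZ : ∀ z ∈ Z, p ^ M • z = 0) {g : A} (hg : g ∈ Z) (hord : addOrderOf g = p ^ M)
    (hcard : Nat.card Z ≤ p ^ M * B) (hB : B ≤ p ^ e) (heM : e ≤ M)
    {z : A} (hz : z ∈ Z) : p ^ e • z ∈ AddSubgroup.zmultiples (p ^ e • g) := by
  have hCZ : AddSubgroup.zmultiples g ≤ Z := AddSubgroup.zmultiples_le.mpr hg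
  have hcardC : Nat.card (AddSubgroup.zmultiples g) = p ^ M := by rw [Nat.card_zmultiples, hord]
  have hmem : p ^ e • z ∈ AddSubgroup.zmultiples g :=
    nsmul_mem_of_card_le Z _ hCZ hZ (by rw [hcardC]; exact hcard) hB hz
  obtain ⟨k, hk⟩ := AddSubgroup.mem_zmultiples_iff.mp hmem
  -- `p^{M-e} (p^e z) = 0` forces `p^e ∣ k`
  have hkill : (k * (p ^ (M - e) : ℕ)) • g = 0 := by
    rw [mul_comm, mul_zsmul, hk, natCast_zsmul, ← mul_nsmul', ← pow_add, Nat.sub_add_cancel heM]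
    exact hZ z hz
  have hdvd : (p ^ M : ℤ) ∣ k * (p ^ (M - e) : ℕ) := by
    have := (addOrderOf_dvd_iff_zsmul_eq_zero).mpr hkill
    rw [hord] at this
    exact_mod_cast this
  have hdvd' : (p : ℤ) ^ e ∣ k := by
    have hsplit : (p ^ M : ℤ) = (p : ℤ) ^ e * (p : ℤ) ^ (M - e) := by
      rw [← pow_add, Nat.add_sub_cancel' heM]
    rw [hsplit] at hdvd
    have hne : (p : ℤ) ^ (M - e) ≠ 0 := pow_ne_zero _ (by exact_mod_cast hp.out.ne_zero)
    have : (p : ℤ) ^ e * (p : ℤ) ^ (M - e) ∣ k * (p : ℤ) ^ (M - e) := by exact_mod_cast hdvd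
    exact (mul_dvd_mul_iff_right hne).mp this
  obtain ⟨k', rfl⟩ := hdvd'
  refine AddSubgroup.mem_zmultiples_iff.mpr ⟨k', ?_⟩
  rw [← hk, mul_comm, mul_zsmul, ← natCast_zsmul g (p ^ e)]
  push_cast
  rfl

/-- **Pull-back of a cyclic group along a homomorphism**: `f⁻¹(ℤ · f κ) = ℤ · κ + ker f`. In (F3): `ι′_{N,*}⁻¹(ℤ · g′_N) = ℤ · κ′_N(P) +
δ_N(W*′(K))` (`ker ι′_{N,*}` = the connecting classes, X11b `map_primaryInclusion_eq_zero_iff`), so a level-`N` dual class whose image lies on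
the Kummer line of `H¹(Γ_K, W*′)` lies in `Λ_N`. [folklore] -/
theorem comap_zmultiples_map_eq {A' : Type*} [AddCommGroup A'] (f : A →+ A') (κ : A) :
    (AddSubgroup.zmultiples (f κ)).comap f = AddSubgroup.zmultiples κ ⊔ f.ker := by
  ext x
  simp only [AddSubgroup.mem_comap, AddSubgroup.mem_zmultiples_iff, AddSubgroup.mem_sup, AddMonoidHom.mem_ker]
  constructor
  · rintro ⟨k, hk⟩
    exact ⟨k • κ, ⟨k, rfl⟩, x - k • κ, by rw [map_sub, map_zsmul, hk, sub_self], add_sub_cancel _ _⟩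
  · rintro ⟨y, ⟨k, rfl⟩, z, hz, rfl⟩
    exact ⟨k, by rw [map_add, map_zsmul, hz, add_zero]⟩

end Summit.BirchSwinnertonDyer.BirchSwinnertonDyer.Theorems.PrintCf2.LocalLineCount
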